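import Summits.QuantumFields.BalabanUV.T4Continuum.Spine.NE4.AutonomousSchemeLinearized

/-!
# Spine/NE4/AutonomousSchemeKink — (R48) THE BOTTOM RUNG ON THE STATE SIDE: without differentiability at the bare state the linearization defect does NOT
# shrink with the ball, and the spectral rate `ρ(T₀)` is NOT approached — the kink scheme `x ↦ θx + c|x|`

Cell `pub-balaban-gaps` (YM blitz G2), seat `ne4`, generation 11 (unit `pub-balaban-gaps-ne4-g11`); record `HOME/ne/NE4.md` §5 (R48).  HONEST FRAMING as in the
other `AutonomousScheme*` files: an explicit TOY scheme on `ℝ` and elementary real analysis; NE4 (`T4CouplingMatching.ScaleShiftRate`, NOT IN PRINT —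
[Balaban1987RG1] = CMP **109** p. 264) is NOT proved; nothing of Bałaban's is asserted; no status word moves.  One finite T⁴; NOT ℝ⁴, NOT a mass gap, NOT Clay.

THE POINT (the state-side analogue of census (R35) `FadingNeedsRegularity`).  (R43) prices the autonomous road at rate `θ′ + Kc·δ`; (R45) shows every rate
above `ρ(T₀)` is reached once `δ` is small; (R46) makes `δ` small — proportional to the radius of the working ball — from ANALYTICITY of the step in the
state.  This file shows that SOME regularity at the bare state beyond Lipschitz continuity is NECESSARY for that: the kink scheme
`kink θ c g x = θ·x + c·|x|` on `ℝ` (coupling-independent; `θ, c ≥ 0`) is globally `(θ + c)`-Lipschitz and orbit-stable at rate `θ + c` with constant `1`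
(`orbitStability_kink`), its linear part at the bare state `0` «is» `T₀ = θ·1` (power bound at rate `θ`), but
* `le_defect_kink`: on EVERY ball `closedBall 0 R₀` (`R₀ > 0`) any linearization defect relative to `θ·1` is `≥ c` — it does NOT shrink with `R₀`
  (contrast (R46) `anDefect ∝ R₀`);
* `not_orbitStability_kink_below`: NO orbit stability at any rate `ρ < θ + c` holds, with any constant, on any invariant set containing `[0, R₀]`
  (the positive half-line is invariant and the scheme is LINEAR with slope `θ + c` there) — so the rates near `ρ(T₀) = θ` promised by (R45) are out of
  reach: the achievable rates are exactly `[θ + c, ∞[` ∩ admissible.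
So on the state side, as on the β-side, the regularity hypothesis is not decoration: Lipschitz steps give the (R42)(e) rate `θ + c` and nothing better;
differentiability at the bare state with a second-order remainder ((R43) §4) or analyticity ((R46)) is what lets the rate descend to the spectral datum.
-/

namespace Summit.QuantumFields.BalabanUV.T4Continuum.Spine.NE4

open Literature.MathematicalPhysics.QuantumFieldTheory.Balaban1983to89.T4FlagMemory (Adm)
open Metric Set

namespace Markov

section Kink

/-- The KINK scheme on `ℝ`: `kink θ c g x = θ·x + c·|x|` (coupling-independent). [folklore] -/
def kink (θ c : ℝ) : ℝ → ℝ → ℝ := fun _ x => θ * x + c * |x|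

/-- [witness] the kink scheme is `(θ + c)`-Lipschitz at every coupling (`θ, c ≥ 0`): one-step contraction at rate `θ + c` on all of `ℝ`. [folklore] -/
theorem stateContraction_kink {θ c γ : ℝ} (hθ : 0 ≤ θ) (hc : 0 ≤ c) : StateContraction (kink θ c) univ (θ + c) γ := by
  intro g _ _ x _ y _
  rw [Real.dist_eq, Real.dist_eq]
  simp only [kink]
  calc |θ * x + c * |x| - (θ * y + c * |y|)| = |θ * (x - y) + c * (|x| - |y|)| := by ring_nf
    _ ≤ |θ * (x - y)| + |c * (|x| - |y|)| := abs_add_le _ _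
    _ = θ * |x - y| + c * |(|x| - |y|)| := by rw [abs_mul, abs_mul, abs_of_nonneg hθ, abs_of_nonneg hc]
    _ ≤ θ * |x - y| + c * |x - y| :=
        add_le_add le_rfl (mul_le_mul_of_nonneg_left (abs_abs_sub_abs_le_abs_sub x y) hc)
    _ = (θ + c) * |x - y| := by ring

/-- [witness] hence orbit stability at rate `θ + c` with constant `1` on `univ` — the (R42)(e) hypothesis holds for the kink scheme. [folklore] -/
theorem orbitStability_kink {θ c γ : ℝ} (hθ : 0 ≤ θ) (hc : 0 ≤ c) : OrbitStability (kink θ c) univ 1 (θ + c) γ :=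
  orbitStability_of_stateContraction (add_nonneg hθ hc) (fun _ _ _ _ _ => mem_univ _) (stateContraction_kink hθ hc)

/-- **THE DEFECT DOES NOT SHRINK WITH THE BALL**: on `closedBall 0 R₀` (`R₀ > 0`, `γ > 0`) any linearization defect of the kink scheme relative to its linear part
`θ·1` is at least `c` — independently of `R₀` (test `x = R₀`, `y = 0`).  Contrast (R46) `linearDefect_of_stateAnalytic` (defect `∝ R₀` under analyticity). [folklore] -/
theorem le_defect_kink {θ c R₀ δ γ : ℝ} (hR : 0 < R₀) (hγ : 0 < γ)
    (h : LinearDefect (kink θ c) (θ • (1 : ℝ →L[ℝ] ℝ)) (closedBall (0 : ℝ) R₀) δ γ) : c ≤ δ := by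
  have hx : R₀ ∈ closedBall (0 : ℝ) R₀ := by rw [mem_closedBall_zero_iff, Real.norm_eq_abs, abs_of_pos hR]
  have h0 : (0 : ℝ) ∈ closedBall (0 : ℝ) R₀ := mem_closedBall_self hR.le
  have key := h γ hγ le_rfl R₀ hx 0 h0
  have e : (kink θ c γ R₀ - kink θ c γ 0) - (θ • (1 : ℝ →L[ℝ] ℝ)) (R₀ - 0) = c * R₀ := by
    change θ * R₀ + c * |R₀| - (θ * 0 + c * |0|) - θ • (R₀ - 0) = c * R₀
    rw [abs_of_pos hR, abs_zero, smul_eq_mul]; ring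
  rw [e, sub_zero, Real.norm_eq_abs, Real.norm_eq_abs, abs_of_pos hR] at key
  have hcR : c * R₀ ≤ δ * R₀ := (le_abs_self _).trans key
  exact le_of_mul_le_mul_right hcR hR

/-- [bookkeeping] along the constant coupling sequence the kink scheme's composites act on `x ≥ 0` as multiplication by `(θ + c)^n` (`θ, c ≥ 0`). [folklore] -/
theorem iter_kink_nonneg {θ c γ : ℝ} (hθ : 0 ≤ θ) (hc : 0 ≤ c) {x : ℝ} (hx : 0 ≤ x) :
    ∀ n, iter (kink θ c) (fun _ => γ) 0 n x = (θ + c) ^ n * x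
  | 0 => by simp
  | n + 1 => by
    rw [iter_succ, iter_kink_nonneg hθ hc hx n]
    have hn : 0 ≤ (θ + c) ^ n * x := mul_nonneg (pow_nonneg (add_nonneg hθ hc) n) hx
    simp only [kink, abs_of_nonneg hn]
    ring

/-- **NO RATE BELOW `θ + c`** — in particular none near the spectral datum `θ` of the linear part: if `S ∋ 0` contains some `x₀ > 0` and the kink scheme is orbit-stable on `S`
at rate `ρ ≥ 0` with constant `C` along admissible sequences in ]0,γ] (`γ > 0`), then `θ + c ≤ ρ`.  (Along the constant sequence the two orbits of `x₀` and `0` stay at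
distance `(θ + c)^n·x₀`, which `C·ρ^n·x₀` cannot dominate for all `n` when `ρ < θ + c`.) [folklore] -/
theorem not_orbitStability_kink_below {θ c γ ρ C x₀ : ℝ} {S : Set ℝ} (hθ : 0 ≤ θ) (hc : 0 ≤ c) (hγ : 0 < γ) (hρ : 0 ≤ ρ)
    (h0 : (0 : ℝ) ∈ S) (hx₀ : x₀ ∈ S) (hx₀pos : 0 < x₀) (h : OrbitStability (kink θ c) S C ρ γ) : θ + c ≤ ρ := by
  by_contra hlt
  rw [not_le] at hlt
  have hadm : Adm γ (fun _ : ℕ => γ) := fun _ => ⟨hγ, le_rfl⟩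
  -- along the constant sequence: (θ+c)^n x₀ ≤ C ρ^n x₀ for all n
  have key : ∀ n : ℕ, (θ + c) ^ n * x₀ ≤ C * ρ ^ n * x₀ := by
    intro n
    have hn := h _ hadm 0 n x₀ hx₀ 0 h0
    rw [iter_kink_nonneg hθ hc hx₀pos.le n, iter_kink_nonneg hθ hc le_rfl n, mul_zero, Real.dist_eq, sub_zero,
      Real.dist_eq, sub_zero, abs_of_pos hx₀pos, abs_of_nonneg (mul_nonneg (pow_nonneg (add_nonneg hθ hc) n) hx₀pos.le)] at hn
    exact hn
  have key' : ∀ n : ℕ, ((θ + c) / ρ) ^ n ≤ C := by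
    intro n
    rcases hρ.eq_or_lt with hρ0 | hρ0
    · -- ρ = 0: then θ + c > 0 and n ≥ 1 gives contradiction unless handled: use n-th bound directly
      rcases Nat.eq_zero_or_pos n with hn0 | hn0
      · subst hn0
        have := key 0
        simp at this
        have : 1 * x₀ ≤ C * x₀ := by simpa using this
        simpa using le_of_mul_le_mul_right this hx₀pos
      · have := key n
        rw [← hρ0, zero_pow (Nat.pos_iff_ne_zero.mp hn0), mul_zero, zero_mul] at this
        have hpos : 0 < (θ + c) ^ n * x₀ := mul_pos (pow_pos (by linarith) n) hx₀pos
        linarith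
    · have := key n
      rw [div_pow, div_le_iff₀ (pow_pos hρ0 n)]
      exact le_of_mul_le_mul_right (by linarith [this]) hx₀pos
  -- but ((θ+c)/ρ)^n is unbounded when (θ+c)/ρ > 1 (or ρ = 0 < θ + c)
  rcases hρ.eq_or_lt with hρ0 | hρ0
  · -- ρ = 0 < θ + c: key 1 gives (θ+c) x₀ ≤ 0
    have := key 1
    rw [← hρ0, pow_one, pow_one, mul_zero, zero_mul] at this
    have hpos : 0 < (θ + c) * x₀ := mul_pos (by linarith) hx₀pos
    linarith
  · have hq : 1 < (θ + c) / ρ := (one_lt_div hρ0).mpr hlt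
    obtain ⟨n, hn⟩ := pow_unbounded_of_one_lt C hq
    exact absurd (key' n) (not_le.mpr hn)

end Kink

end Markov

end Summit.QuantumFields.BalabanUV.T4Continuum.Spine.NE4
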